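import Mathlib
import HarnessLib
import Summits.HubbardSuperconductivity.HubbardSuperconductivity.Theorems.KLProgrammeKLRegimeSplitTwoLegReadJetBoundOfSymbol
import Summits.HubbardSuperconductivity.HubbardSuperconductivity.Theorems.KLProgrammeKLRegimeFlowReadResidueSplit

/-!
# Route `KLProgramme`, crux K3 — gen-8 ENGINE-FLOW child (stmt-HubbardSuperconductivity-20437 `KLRegimeEngineV17F2`), stub (C)
# `stub_twoLeg_curvature`: «(B)-FIT» — the frame-RESPONSE bracket (B) of the residue split in `readResidue_flow_hP`'s currency from SYMBOL SIZES of
# p2's response symbol at the curve points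

Seat hubbard-kl-k3c3-p1 (g10; row «δμ-flow with klAngularMean constant piece»).  The residue `ν_n(K_{n+1}) = (B) + (C2) + (C1)` (k3c3-p3's
`klLocalPart_flow_residue_split`) has (C1) in the tree in `curveJetBar` currency (this seat, `…ReadResidueC1Fit`/`TabFit`), (C2) too (`…FlowReadTransportFit`);
the (B) door of record (p2 g15, `…FrameShiftDressingSupFlowTablesGN.…_aliasing_gevrey_numeral4`, last-step twin `…SupFlowLast`) is stated ONE LEVEL UP —
momentum-space jets of the RESPONSE SYMBOL
  `F_B := evalM (symInterp L (k ↦ σ_n^{K_{n+1}}(k) − σ_n^{K_n}(k) − (K_{n+1} ⊖ K_n)(p_k)))`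
(`σ_n^K = klLocSelfEnergyRe … K n`).  This file is the consumer-side fit, the exact (B) twin of k3c3-p3's `twoLegReadJetBound_of_symbolSizes` (p52xxxx):

* §1 `frameResponse_eq_symbol_comp` — the (B) function of `readResidue_flow_hP` (difference of the two K-separated symbols read at `k_F^{K_{n+1}}θ`) IS
  `F_B ∘ γ_{K_{n+1}}` (linearity of `symInterp`, `eval_fsub`);
* §2 **`frameResponse_hB_of_symbolSizes`** — in the regime (`0 < c ≤ klCurveC3 R`, `0 < U ≤ min (klCurveU0 R) 1`, `klBetaMin ≤ β ≤ e^{c/U²}`, `μ ∈ klWindowC`),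
  for `FrameOK R U N μ K_{n+1}` of depth `N ≤ n + 1`, `N ≤ nScales β` (the flow frame `K_{n+1}` has depth `n`: `frameOK_klFlowFrameU_succ`), IF the response
  symbol has the BGM-shape sizes AT THE CURVE POINTS
  `|F_B(γθ)| ≤ μc 0·U²·4^{−2(n+1)}` (VALUE, pure `U²` currency — every response term carries the frame shift `‖K_{n+1} − K_n‖ = O(|U|·16^{−n})`) and
  `‖DˡF_B(γθ)‖ ≤ μc l·U²·4^{(l−2)(n+1)}` (`1 ≤ l ≤ 4`), THEN the LITERAL pair `(hBdiff, hB)` of `readResidue_flow_hP` holds with the n-FREE tables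
  `eB = (0, readJetC μc 1…4)`, `eB′ = (μc 0, readJetC′ R μc ·)` (k3c3-p3's structured chain rule `abs_iteratedDeriv_comp_fermiPointLp_le_curveJetBar`);
  `…_of_global` — the same from GLOBAL momentum-space sizes (the shape p2's door delivers);
* §3 `frameResponse_osc_of_symbolSize` — the `k = 0` row in the mean-free clause's currency (`|(B)(θ) − 0| ≤ μc 0·U²·4^{−2(n+1)}`: the `hB` input of
  `twoLegReadOscAt_flow_succ_of_doors_klReadOscC` with `τ_B = 0`, `b = μc 0`; un-primed `k = 0` entry ZERO, as «(P)-OSC» requires).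

What remains for the (P) closer on the (B) side is ARITHMETIC ONLY: p2's closed right-hand sides `≤ μc l·U²·4^{(l−2)(n+1)}` at the curve points (their G6 /
budget word).  Proofs only (one lambda table, no definition); nothing here asserts any stub of 20437, K3 or superconductivity.
References: BGM 2006 §2.3 (2.21)–(2.24), §2.4 (2.36) [cite: BenfattoGiulianiMastropietro2006].
-/

noncomputable section

namespace Summit.HubbardSuperconductivity.HubbardSuperconductivity.Theorems.KLRegimeSplit

set_option linter.dupNamespace false -- summit = problem name (single-conjunct summit), D-0017

open Real Finset Literature.MathematicalPhysics.QuantumLattice Literature.Probability.LatticeModels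
open Summit.HubbardSuperconductivity.HubbardSuperconductivity.Theorems.DispersionFlow
open Summit.HubbardSuperconductivity.HubbardSuperconductivity.Theorems.PerturbedFermiCurve

section Model

variable {L M : ℕ} [NeZero L] [NeZero M]

/-! ## §1 The (B) bracket is the response symbol read along the new curve -/

/-- **(B) = `F_B ∘ γ_{K}`**: for any frames `K₀, K` and scale `n`, the difference of the two K-separated symbols read at `k_F^{K} θ` is the response symbol
`evalM (symInterp L (k ↦ σ_n^{K}(k) − σ_n^{K₀}(k) − (K ⊖ K₀)(p_k)))` composed with `θ ↦ γ_K(θ)`. -/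
theorem frameResponse_eq_symbol_comp (β U μ : ℝ) (K₀ K : TrigPolyC4v) (n : ℕ) :
    (fun θ : ℝ =>
      (symInterp L (fun k => klLocSelfEnergyRe L M β U μ K n k - K.eval (latticeMomentum L k))).eval (klFermiPoint μ K θ) -
        (symInterp L (fun k => klLocSelfEnergyRe L M β U μ K₀ n k - K₀.eval (latticeMomentum L k))).eval (klFermiPoint μ K θ)) =
      evalM (symInterp L (fun kv : TorusSite 2 L =>
          klLocSelfEnergyRe L M β U μ K n kv - klLocSelfEnergyRe L M β U μ K₀ n kv - (fsub K K₀).eval (latticeMomentum L kv))) ∘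
        fun θ : ℝ => (WithLp.toLp 2 (klFermiPoint μ K θ) : Momentum) := by
  funext θ
  have hfun : (fun kv : TorusSite 2 L =>
      klLocSelfEnergyRe L M β U μ K n kv - klLocSelfEnergyRe L M β U μ K₀ n kv - (fsub K K₀).eval (latticeMomentum L kv)) =
      fun kv => (klLocSelfEnergyRe L M β U μ K n kv - K.eval (latticeMomentum L kv)) -
        (klLocSelfEnergyRe L M β U μ K₀ n kv - K₀.eval (latticeMomentum L kv)) := by
    funext kv; rw [eval_fsub]; ring
  simp only [Function.comp_apply, evalM]
  rw [hfun]
  exact (eval_symInterp_sub L _ _ _).symm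

/-- The flow instance: `K₀ = K_n`, `K = K_{n+1}` (the function in `readResidue_flow_hP`'s `hBdiff`/`hB`, and p2's door object). -/
theorem frameResponse_flow_eq_symbol_comp (β U μ : ℝ) (n : ℕ) :
    (fun θ : ℝ =>
      (symInterp L (fun k => klLocSelfEnergyRe L M β U μ (klFlowFrameU L M β U μ (n + 1)) n k -
            (klFlowFrameU L M β U μ (n + 1)).eval (latticeMomentum L k))).eval (klFermiPoint μ (klFlowFrameU L M β U μ (n + 1)) θ) -
        (symInterp L (fun k => klLocSelfEnergyRe L M β U μ (klFlowFrameU L M β U μ n) n k -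
            (klFlowFrameU L M β U μ n).eval (latticeMomentum L k))).eval (klFermiPoint μ (klFlowFrameU L M β U μ (n + 1)) θ)) =
      evalM (symInterp L (fun kv : TorusSite 2 L =>
          klLocSelfEnergyRe L M β U μ (klFlowFrameU L M β U μ (n + 1)) n kv - klLocSelfEnergyRe L M β U μ (klFlowFrameU L M β U μ n) n kv -
            (fsub (klFlowFrameU L M β U μ (n + 1)) (klFlowFrameU L M β U μ n)).eval (latticeMomentum L kv))) ∘
        fun θ : ℝ => (WithLp.toLp 2 (klFermiPoint μ (klFlowFrameU L M β U μ (n + 1)) θ) : Momentum) :=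
  frameResponse_eq_symbol_comp β U μ (klFlowFrameU L M β U μ n) (klFlowFrameU L M β U μ (n + 1)) n

/-! ## §2 The fit: symbol sizes at the curve points ⇒ `(hBdiff, hB)` -/

variable {R : RenConsts} {c U β μ : ℝ} {N n : ℕ} {μc : ℕ → ℝ}

/-- **«(B)-FIT» — THE (B) DOOR IN `readResidue_flow_hP`'S CURRENCY FROM FIVE SYMBOL SIZES AT THE CURVE POINTS.**  In the regime, for the new frame
`K_{n+1}` admissible at depth `N ≤ n+1` (`N ≤ nScales β`): if the response symbol `F_B` has `|F_B(γθ)| ≤ μc 0·U²·4^{−2(n+1)}` and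
`‖DˡF_B(γθ)‖ ≤ μc l·U²·4^{(l−2)(n+1)}` (`1 ≤ l ≤ 4`) at every curve point `γθ = k_F^{K_{n+1}}θ`, then the (B) bracket is `C⁴` in `θ` with
`|∂ᵏ(B)(θ)| ≤ curveJetBar eB eB′ U k (n+1)`, `eB = (0, readJetC μc ·)`, `eB′ = (μc 0, readJetC′ R μc ·)` — the literal `(hBdiff, hB)` of `readResidue_flow_hP`. -/
theorem frameResponse_hB_of_symbolSizes (hR : ∀ j, 0 ≤ R.Gfr j) (hc : 0 < c) (hcle : c ≤ klCurveC3 R) (hU : 0 < U)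
    (hUle : U ≤ klCurveU0 R) (hU1 : U ≤ 1) (hβmin : klBetaMin ≤ β) (hβc : β ≤ Real.exp (c / U ^ 2)) (hμ : μ ∈ klWindowC)
    (hK : FrameOK R U N μ (klFlowFrameU L M β U μ (n + 1))) (hNn : N ≤ n + 1) (hNβ : N ≤ nScales β) (hμc : ∀ l, 0 ≤ μc l)
    (h0 : ∀ θ : ℝ, |evalM (symInterp L (fun kv : TorusSite 2 L =>
          klLocSelfEnergyRe L M β U μ (klFlowFrameU L M β U μ (n + 1)) n kv - klLocSelfEnergyRe L M β U μ (klFlowFrameU L M β U μ n) n kv -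
            (fsub (klFlowFrameU L M β U μ (n + 1)) (klFlowFrameU L M β U μ n)).eval (latticeMomentum L kv)))
          (WithLp.toLp 2 (klFermiPoint μ (klFlowFrameU L M β U μ (n + 1)) θ))| ≤
        μc 0 * U ^ 2 * (4 : ℝ) ^ ((((0 : ℕ) : ℤ) - 2) * ((n + 1 : ℕ) : ℤ)))
    (hm : ∀ θ : ℝ, ∀ l, 1 ≤ l → l ≤ 4 →
      ‖iteratedFDeriv ℝ l (evalM (symInterp L (fun kv : TorusSite 2 L =>
          klLocSelfEnergyRe L M β U μ (klFlowFrameU L M β U μ (n + 1)) n kv - klLocSelfEnergyRe L M β U μ (klFlowFrameU L M β U μ n) n kv -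
            (fsub (klFlowFrameU L M β U μ (n + 1)) (klFlowFrameU L M β U μ n)).eval (latticeMomentum L kv))))
          (WithLp.toLp 2 (klFermiPoint μ (klFlowFrameU L M β U μ (n + 1)) θ))‖ ≤
        μc l * U ^ 2 * (4 : ℝ) ^ (((l : ℤ) - 2) * ((n + 1 : ℕ) : ℤ))) :
    ContDiff ℝ 4 (fun θ : ℝ =>
      (symInterp L (fun k => klLocSelfEnergyRe L M β U μ (klFlowFrameU L M β U μ (n + 1)) n k -
            (klFlowFrameU L M β U μ (n + 1)).eval (latticeMomentum L k))).eval (klFermiPoint μ (klFlowFrameU L M β U μ (n + 1)) θ) -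
        (symInterp L (fun k => klLocSelfEnergyRe L M β U μ (klFlowFrameU L M β U μ n) n k -
            (klFlowFrameU L M β U μ n).eval (latticeMomentum L k))).eval (klFermiPoint μ (klFlowFrameU L M β U μ (n + 1)) θ)) ∧
    ∀ k ≤ 4, ∀ θ : ℝ, |iteratedDeriv k (fun θ : ℝ =>
      (symInterp L (fun k => klLocSelfEnergyRe L M β U μ (klFlowFrameU L M β U μ (n + 1)) n k -
            (klFlowFrameU L M β U μ (n + 1)).eval (latticeMomentum L k))).eval (klFermiPoint μ (klFlowFrameU L M β U μ (n + 1)) θ) -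
        (symInterp L (fun k => klLocSelfEnergyRe L M β U μ (klFlowFrameU L M β U μ n) n k -
            (klFlowFrameU L M β U μ n).eval (latticeMomentum L k))).eval (klFermiPoint μ (klFlowFrameU L M β U μ (n + 1)) θ)) θ| ≤
      curveJetBar (fun k => if k = 0 then 0 else readJetC μc k) (fun k => if k = 0 then μc 0 else readJetC' R μc k) U k (n + 1) := by
  have hK' : FrameOK R U (nScales β) μ (klFlowFrameU L M β U μ (n + 1)) := FrameOK.mono hR hNβ hK
  obtain ⟨hA₃, hA₄⟩ := frameShift_high_sizes_of_frameOK hR hK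
  have hγ := (fermiPointLp_sizes_explicit hR hc hcle hU hUle hβmin hβc hμ hK' hA₃ hA₄ 0).1
  set F : Momentum → ℝ := evalM (symInterp L (fun kv : TorusSite 2 L =>
      klLocSelfEnergyRe L M β U μ (klFlowFrameU L M β U μ (n + 1)) n kv - klLocSelfEnergyRe L M β U μ (klFlowFrameU L M β U μ n) n kv -
        (fsub (klFlowFrameU L M β U μ (n + 1)) (klFlowFrameU L M β U μ n)).eval (latticeMomentum L kv))) with hFdef
  have hF : ContDiff ℝ 4 F := contDiff_evalM _
  have hcomp := frameResponse_flow_eq_symbol_comp (L := L) (M := M) β U μ n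
  refine ⟨?_, fun k hk θ => ?_⟩
  · rw [hcomp]; exact hF.comp hγ
  · rw [hcomp]
    rcases Nat.eq_zero_or_pos k with rfl | hkpos
    · -- order 0: the value, booked in the `|U|`-suppressed column
      rw [iteratedDeriv_zero, curveJetBar_apply]
      simp only [if_true, Function.comp_apply, uPow_zero, zero_add]
      have h := h0 θ
      calc _ ≤ μc 0 * U ^ 2 * (4 : ℝ) ^ ((((0 : ℕ) : ℤ) - 2) * ((n + 1 : ℕ) : ℤ)) := h
        _ = μc 0 * |U| * |U| * (4 : ℝ) ^ ((((0 : ℕ) : ℤ) - 2) * ((n + 1 : ℕ) : ℤ)) := by rw [← sq_abs U]; ring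
    · have h := abs_iteratedDeriv_comp_fermiPointLp_le_curveJetBar hR hc hcle hU hUle hU1 hβmin hβc hμ hK hNn hNβ hF hμc θ (hm θ) hkpos hk
      refine h.trans (le_of_eq ?_)
      rw [curveJetBar_apply, curveJetBar_apply]
      simp only [show k ≠ 0 by omega, if_false]

/-- **«(B)-FIT» from GLOBAL momentum-space sizes** (the shape p2's door delivers: `sup_q ‖DˡF_B(q)‖`). -/
theorem frameResponse_hB_of_symbolSizes_of_global (hR : ∀ j, 0 ≤ R.Gfr j) (hc : 0 < c) (hcle : c ≤ klCurveC3 R) (hU : 0 < U)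
    (hUle : U ≤ klCurveU0 R) (hU1 : U ≤ 1) (hβmin : klBetaMin ≤ β) (hβc : β ≤ Real.exp (c / U ^ 2)) (hμ : μ ∈ klWindowC)
    (hK : FrameOK R U N μ (klFlowFrameU L M β U μ (n + 1))) (hNn : N ≤ n + 1) (hNβ : N ≤ nScales β) (hμc : ∀ l, 0 ≤ μc l)
    (h0 : ∀ q : Momentum, |evalM (symInterp L (fun kv : TorusSite 2 L =>
          klLocSelfEnergyRe L M β U μ (klFlowFrameU L M β U μ (n + 1)) n kv - klLocSelfEnergyRe L M β U μ (klFlowFrameU L M β U μ n) n kv -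
            (fsub (klFlowFrameU L M β U μ (n + 1)) (klFlowFrameU L M β U μ n)).eval (latticeMomentum L kv))) q| ≤
        μc 0 * U ^ 2 * (4 : ℝ) ^ ((((0 : ℕ) : ℤ) - 2) * ((n + 1 : ℕ) : ℤ)))
    (hm : ∀ q : Momentum, ∀ l, 1 ≤ l → l ≤ 4 →
      ‖iteratedFDeriv ℝ l (evalM (symInterp L (fun kv : TorusSite 2 L =>
          klLocSelfEnergyRe L M β U μ (klFlowFrameU L M β U μ (n + 1)) n kv - klLocSelfEnergyRe L M β U μ (klFlowFrameU L M β U μ n) n kv -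
            (fsub (klFlowFrameU L M β U μ (n + 1)) (klFlowFrameU L M β U μ n)).eval (latticeMomentum L kv)))) q‖ ≤
        μc l * U ^ 2 * (4 : ℝ) ^ (((l : ℤ) - 2) * ((n + 1 : ℕ) : ℤ))) :
    ContDiff ℝ 4 (fun θ : ℝ =>
      (symInterp L (fun k => klLocSelfEnergyRe L M β U μ (klFlowFrameU L M β U μ (n + 1)) n k -
            (klFlowFrameU L M β U μ (n + 1)).eval (latticeMomentum L k))).eval (klFermiPoint μ (klFlowFrameU L M β U μ (n + 1)) θ) -
        (symInterp L (fun k => klLocSelfEnergyRe L M β U μ (klFlowFrameU L M β U μ n) n k -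
            (klFlowFrameU L M β U μ n).eval (latticeMomentum L k))).eval (klFermiPoint μ (klFlowFrameU L M β U μ (n + 1)) θ)) ∧
    ∀ k ≤ 4, ∀ θ : ℝ, |iteratedDeriv k (fun θ : ℝ =>
      (symInterp L (fun k => klLocSelfEnergyRe L M β U μ (klFlowFrameU L M β U μ (n + 1)) n k -
            (klFlowFrameU L M β U μ (n + 1)).eval (latticeMomentum L k))).eval (klFermiPoint μ (klFlowFrameU L M β U μ (n + 1)) θ) -
        (symInterp L (fun k => klLocSelfEnergyRe L M β U μ (klFlowFrameU L M β U μ n) n k -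
            (klFlowFrameU L M β U μ n).eval (latticeMomentum L k))).eval (klFermiPoint μ (klFlowFrameU L M β U μ (n + 1)) θ)) θ| ≤
      curveJetBar (fun k => if k = 0 then 0 else readJetC μc k) (fun k => if k = 0 then μc 0 else readJetC' R μc k) U k (n + 1) :=
  frameResponse_hB_of_symbolSizes hR hc hcle hU hUle hU1 hβmin hβc hμ hK hNn hNβ hμc (fun _ => h0 _) (fun _ l hl1 hl4 => hm _ l hl1 hl4)

/-! ## §3 The `k = 0` row in the mean-free clause's currency -/

/-- **The (B) value row for «(P)-OSC»**: `|(B)(θ) − 0| ≤ μc 0·U²·4^{−2(n+1)}` from the value size of the response symbol at the curve point — the `hB`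
input of `twoLegReadOscAt_flow_succ_of_doors_klReadOscC` with `τ_B := 0`, `b := μc 0`. -/
theorem frameResponse_osc_of_symbolSize (β U μ : ℝ) (n : ℕ) {b : ℝ}
    (h0 : ∀ θ : ℝ, |evalM (symInterp L (fun kv : TorusSite 2 L =>
          klLocSelfEnergyRe L M β U μ (klFlowFrameU L M β U μ (n + 1)) n kv - klLocSelfEnergyRe L M β U μ (klFlowFrameU L M β U μ n) n kv -
            (fsub (klFlowFrameU L M β U μ (n + 1)) (klFlowFrameU L M β U μ n)).eval (latticeMomentum L kv)))
          (WithLp.toLp 2 (klFermiPoint μ (klFlowFrameU L M β U μ (n + 1)) θ))| ≤ b * U ^ 2 * (4 : ℝ) ^ (-2 * ((n + 1 : ℕ) : ℤ))) (θ : ℝ) :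
    |((symInterp L (fun k => klLocSelfEnergyRe L M β U μ (klFlowFrameU L M β U μ (n + 1)) n k -
            (klFlowFrameU L M β U μ (n + 1)).eval (latticeMomentum L k))).eval (klFermiPoint μ (klFlowFrameU L M β U μ (n + 1)) θ) -
        (symInterp L (fun k => klLocSelfEnergyRe L M β U μ (klFlowFrameU L M β U μ n) n k -
            (klFlowFrameU L M β U μ n).eval (latticeMomentum L k))).eval (klFermiPoint μ (klFlowFrameU L M β U μ (n + 1)) θ)) - 0| ≤
      b * U ^ 2 * (4 : ℝ) ^ (-2 * ((n + 1 : ℕ) : ℤ)) := by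
  rw [sub_zero]
  have hcomp := frameResponse_flow_eq_symbol_comp (L := L) (M := M) β U μ n
  have h := congrFun hcomp θ
  simp only [Function.comp_apply] at h
  rw [h]
  exact h0 θ

end Model

end Summit.HubbardSuperconductivity.HubbardSuperconductivity.Theorems.KLRegimeSplit

end
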